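import Literature.Topology.FourManifolds.TrisectionsRadialThickening
import Literature.Topology.FourManifolds.MilnorChartIndex
import Literature.Topology.FourManifolds.LatticeFormsDefinite
import Mathlib.LinearAlgebra.QuadraticForm.Signature
import HarnessLib

/-!
# The tube function about an attaching circle, in Milnor's coordinates of a `2`-handle

Topic `Literature/Topology/FourManifolds`; model-space calculus for the fact seat
`provefact-Literature.Topology.FourManifolds.exists_isBalancedGKTrisection` (Gay–Kirby 2016,
Thm. 4 via §4, Lemma 14).  Everything in this file is **proved**; the `def`s are explicit
functions on the model spaces (no named facts).

In Milnor's coordinates `u = (x, y) ∈ ℝ² × ℝ²` about a critical point `c` of index `2` of the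
Morse function `f` of the handle decomposition — `f = f(c) - |x|² + |y|²`, gradient-like field
`ξ = (-x, y)` (*Lectures on the h-cobordism theorem* (1965), Def. 3.1) — the level
`Y = f⁻¹(f(c) - η)` is `{|x|² = η + |y|²}`, the attaching circle of the `2`-handle is
`L = {y = 0, |x|² = η}`, and the flow of `ξ` preserves the "angle" functions of `x` that are
homogeneous of degree `0` and the product `|x|²|y|²`.  The **tube function**
`𝒯(x, y) = 1 - ε x₀²/|x|² + (κ/η) |x|²|y|²`
is such a flow-invariant function; on `Y` it equals `1 - ε cos²θ + κ |y|² (1 + |y|²/η)`, a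
standard "height on the circle plus transverse square": restricted to `Y` its only critical
points near `L` are the four points `θ ∈ {0, π}` (minima, index `0`) and `θ = ±π/2` (index
`1`) of `L`.  This is the explicit germ near the attaching link of the Heegaard function of a
Morse-theoretic construction of Gay–Kirby's trisection (the link is then a union of closures
of descending arcs).  `𝒯` is a radial thickening in the sense of
`TrisectionsRadialThickening.lean` (`𝒯 = rthicken Φ`, `Φ(x₀, x₁, b) = 1 - ε x₀²/|x|² + (κ/η)|x|² b`),
which supplies its first and second derivatives; this file computes the planar core
`g(x) = 1 - ε x₀²/|x|²`, the resulting `4`-dimensional Hessians at the four points, and the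
signatures of their restrictions to the tangent hyperplanes `{v₀ = 0}`, `{v₁ = 0}` of the
level (to be fed to `RegularLevelMorseData.lean`).

## References

* J. Milnor, *Lectures on the h-cobordism theorem* (1965), Def. 3.1, proof of Thm. 3.13.
  [MilnorHCobordism1965]
* D. Gay, R. Kirby, *Trisecting 4-manifolds*, Geom. Topol. 20 (2016), §4, Lemma 14.
  [GayKirby2016]
* J. Milnor, *Morse theory* (1963), §2. [Milnor1963]
-/

open scoped Manifold ContDiff Topology
open Set Function Filter

noncomputable section

namespace Literature.Topology.FourManifolds

/-- Local notation: `𝔼 n` is the model Euclidean space `EuclideanSpace ℝ (Fin n)`. -/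
local notation "𝔼 " n:arg => EuclideanSpace ℝ (Fin n)

namespace TubeModel

open RadialThickening
open PlanarThickening (lift ez)

/-! ### The planar core `g(x) = 1 - ε x₀² / |x|²` -/

/-- The coordinate functionals `dx₀`, `dx₁` on `ℝ²`. [folklore] -/
abbrev d0 : 𝔼 2 →L[ℝ] ℝ := EuclideanSpace.proj (0 : Fin 2)

/-- The coordinate functional `dx₁` on `ℝ²`. [folklore] -/
abbrev d1 : 𝔼 2 →L[ℝ] ℝ := EuclideanSpace.proj (1 : Fin 2)

/-- `dx₀ x = x₀`. [folklore] -/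
@[simp] theorem d0_apply (x : 𝔼 2) : d0 x = x 0 := rfl

/-- `dx₁ x = x₁`. [folklore] -/
@[simp] theorem d1_apply (x : 𝔼 2) : d1 x = x 1 := rfl

/-- `|x|² = x₀² + x₁²` on `ℝ²`. [folklore] -/
def nsq (x : 𝔼 2) : ℝ := x 0 ^ 2 + x 1 ^ 2

/-- Unfolding of `nsq`. [folklore] -/
theorem nsq_apply (x : 𝔼 2) : nsq x = x 0 ^ 2 + x 1 ^ 2 := rfl

/-- `|x|²` is smooth. [folklore] -/
theorem contDiff_nsq {m : WithTop ℕ∞} : ContDiff ℝ m nsq :=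
  ((d0.contDiff).pow 2).add ((d1.contDiff).pow 2)

/-- `d|x|²_x = 2 x₀ dx₀ + 2 x₁ dx₁`. [folklore] -/
theorem hasFDerivAt_nsq (x : 𝔼 2) :
    HasFDerivAt nsq ((2 * x 0) • (d0 : 𝔼 2 →L[ℝ] ℝ) + (2 * x 1) • (d1 : 𝔼 2 →L[ℝ] ℝ)) x := by
  have h0 : HasFDerivAt (fun x : 𝔼 2 => (d0 : 𝔼 2 →L[ℝ] ℝ) x ^ 2) _ x := (d0.hasFDerivAt (x := x)).pow 2
  have h1 : HasFDerivAt (fun x : 𝔼 2 => (d1 : 𝔼 2 →L[ℝ] ℝ) x ^ 2) _ x := (d1.hasFDerivAt (x := x)).pow 2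
  refine (h0.add h1).congr_fderiv ?_
  ext v
  simp

/-- **The planar core** of the tube function: `g(x) = 1 - ε x₀² / |x|²` (`= 1 - ε cos²θ` in
polar coordinates), a function of the angle alone. [cite: GayKirby2016, §4, Lemma 14] -/
def gcore (ε : ℝ) (x : 𝔼 2) : ℝ := 1 - ε * (x 0 ^ 2 / nsq x)

/-- Unfolding of `gcore`. [folklore] -/
theorem gcore_apply (ε : ℝ) (x : 𝔼 2) : gcore ε x = 1 - ε * (x 0 ^ 2 / nsq x) := rfl

/-- `g` is homogeneous of degree `0`: `g(t x) = g(x)` for `t ≠ 0`. [folklore] -/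
theorem gcore_smul {ε t : ℝ} (ht : t ≠ 0) (x : 𝔼 2) : gcore ε (t • x) = gcore ε x := by
  simp only [gcore_apply, nsq_apply, PiLp.smul_apply, smul_eq_mul]
  by_cases hx : x 0 ^ 2 + x 1 ^ 2 = 0
  · have h0 : x 0 = 0 := by nlinarith [sq_nonneg (x 0), sq_nonneg (x 1)]
    have h1 : x 1 = 0 := by nlinarith [sq_nonneg (x 0), sq_nonneg (x 1)]
    simp [h0, h1]
  · have ht2 : t ^ 2 ≠ 0 := pow_ne_zero 2 ht
    have hx' : (t * x 0) ^ 2 + (t * x 1) ^ 2 ≠ 0 := by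
      rw [show (t * x 0) ^ 2 + (t * x 1) ^ 2 = t ^ 2 * (x 0 ^ 2 + x 1 ^ 2) by ring]
      exact mul_ne_zero ht2 hx
    have key : (t * x 0) ^ 2 / ((t * x 0) ^ 2 + (t * x 1) ^ 2) = x 0 ^ 2 / (x 0 ^ 2 + x 1 ^ 2) := by
      rw [div_eq_div_iff hx' hx]; ring
    rw [key]

/-- **The derivative of the planar core**, for `x ≠ 0`:
`dg_x = (2 ε x₀ x₁ / |x|⁴) (x₀ dx₁ - x₁ dx₀)`. [folklore] -/
theorem hasFDerivAt_gcore (ε : ℝ) {x : 𝔼 2} (hx : nsq x ≠ 0) :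
    HasFDerivAt (gcore ε)
      ((2 * ε * x 0 * x 1 / nsq x ^ 2) • ((x 0) • (d1 : 𝔼 2 →L[ℝ] ℝ) - (x 1) • (d0 : 𝔼 2 →L[ℝ] ℝ))) x := by
  have hN : HasFDerivAt (fun x : 𝔼 2 => (d0 : 𝔼 2 →L[ℝ] ℝ) x ^ 2) ((2 * x 0) • (d0 : 𝔼 2 →L[ℝ] ℝ)) x := by
    have := (d0.hasFDerivAt (x := x)).pow 2
    refine this.congr_fderiv ?_
    ext v; simp
  have hD := hasFDerivAt_nsq x
  have hinv : HasFDerivAt (fun y : 𝔼 2 => (nsq y)⁻¹)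
      ((-(nsq x ^ 2)⁻¹) • ((2 * x 0) • (d0 : 𝔼 2 →L[ℝ] ℝ) + (2 * x 1) • (d1 : 𝔼 2 →L[ℝ] ℝ))) x :=
    (hasDerivAt_inv hx).comp_hasFDerivAt x hD
  have hq : HasFDerivAt (fun y : 𝔼 2 => (d0 : 𝔼 2 →L[ℝ] ℝ) y ^ 2 * (nsq y)⁻¹) _ x := hN.mul hinv
  have h := (hq.const_mul ε).const_sub 1
  have hfun : gcore ε = fun y => 1 - ε * ((d0 : 𝔼 2 →L[ℝ] ℝ) y ^ 2 * (nsq y)⁻¹) := by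
    funext y; simp [gcore_apply, div_eq_mul_inv]
  rw [hfun]
  refine h.congr_fderiv ?_
  ext v
  simp only [smul_apply, sub_apply, d0_apply, d1_apply, smul_eq_mul, neg_apply, add_apply]
  rw [nsq_apply] at hx ⊢
  field_simp
  ring

/-- `fderiv` of the planar core, for `x ≠ 0`. [folklore] -/
theorem fderiv_gcore (ε : ℝ) {x : 𝔼 2} (hx : nsq x ≠ 0) :
    fderiv ℝ (gcore ε) x =
      (2 * ε * x 0 * x 1 / nsq x ^ 2) • ((x 0) • (d1 : 𝔼 2 →L[ℝ] ℝ) - (x 1) • (d0 : 𝔼 2 →L[ℝ] ℝ)) :=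
  (hasFDerivAt_gcore ε hx).fderiv

/-- The planar core is smooth away from the origin. [folklore] -/
theorem contDiffAt_gcore {m : WithTop ℕ∞} (ε : ℝ) {x : 𝔼 2} (hx : nsq x ≠ 0) :
    ContDiffAt ℝ m (gcore ε) x := by
  have hN : ContDiff ℝ m (fun x : 𝔼 2 => x 0 ^ 2) := (d0.contDiff).pow 2
  exact contDiffAt_const.sub ((hN.contDiffAt.div contDiff_nsq.contDiffAt hx).const_smul ε |>.congr_of_eventuallyEq
    (Eventually.of_forall fun y => by simp [smul_eq_mul]))

/-- **Critical points of the planar core**: for `x ≠ 0` and `ε ≠ 0`, `dg_x = 0` iff `x₀ x₁ = 0`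
(the two coordinate axes: the angles `θ ∈ {0, π/2, π, 3π/2}`). [cite: GayKirby2016, §4, Lemma 14] -/
theorem fderiv_gcore_eq_zero_iff {ε : ℝ} (hε : ε ≠ 0) {x : 𝔼 2} (hx : nsq x ≠ 0) :
    fderiv ℝ (gcore ε) x = 0 ↔ x 0 * x 1 = 0 := by
  rw [fderiv_gcore ε hx]
  constructor
  · intro h
    by_contra hne
    obtain ⟨hx0, hx1⟩ := mul_ne_zero_iff.1 hne
    have hcoef : 2 * ε * x 0 * x 1 / nsq x ^ 2 ≠ 0 :=
      div_ne_zero (mul_ne_zero (mul_ne_zero (mul_ne_zero two_ne_zero hε) hx0) hx1) (pow_ne_zero 2 hx)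
    have hform : (x 0) • (d1 : 𝔼 2 →L[ℝ] ℝ) - (x 1) • (d0 : 𝔼 2 →L[ℝ] ℝ) = 0 := by
      rcases smul_eq_zero.1 h with h | h
      · exact absurd h hcoef
      · exact h
    have h1 := congrArg (fun L : 𝔼 2 →L[ℝ] ℝ => L (EuclideanSpace.single 1 1)) hform
    simp at h1
    exact hx0 h1
  · intro h
    rw [show 2 * ε * x 0 * x 1 = 2 * ε * (x 0 * x 1) by ring, h]
    simp

/-! ### Second derivatives of the planar core at the points of the axes -/

/-- The scalar coefficient `c(x) = 2 ε x₀ x₁ / |x|⁴` of `dg`. [folklore] -/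
def coef (ε : ℝ) (x : 𝔼 2) : ℝ := 2 * ε * x 0 * x 1 / nsq x ^ 2

/-- The covector field `V(x) = x₀ dx₁ - x₁ dx₀` of `dg = c V`. [folklore] -/
def rotForm (x : 𝔼 2) : 𝔼 2 →L[ℝ] ℝ := (x 0) • (d1 : 𝔼 2 →L[ℝ] ℝ) - (x 1) • (d0 : 𝔼 2 →L[ℝ] ℝ)

/-- `V(x) w = x₀ w₁ - x₁ w₀`. [folklore] -/
@[simp] theorem rotForm_apply (x w : 𝔼 2) : rotForm x w = x 0 * w 1 - x 1 * w 0 := by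
  simp [rotForm]

/-- `dg = c • V` away from the origin. [folklore] -/
theorem fderiv_gcore_eq (ε : ℝ) {x : 𝔼 2} (hx : nsq x ≠ 0) :
    fderiv ℝ (gcore ε) x = coef ε x • rotForm x :=
  fderiv_gcore ε hx

/-- `V` is linear in `x`: `DV_x(v) = v₀ dx₁ - v₁ dx₀`. [folklore] -/
theorem hasFDerivAt_rotForm (x : 𝔼 2) :
    HasFDerivAt rotForm ((d0 : 𝔼 2 →L[ℝ] ℝ).smulRight (d1 : 𝔼 2 →L[ℝ] ℝ) -
      (d1 : 𝔼 2 →L[ℝ] ℝ).smulRight (d0 : 𝔼 2 →L[ℝ] ℝ)) x :=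
  ((d0.hasFDerivAt (x := x)).smul_const (d1 : 𝔼 2 →L[ℝ] ℝ)).sub
    ((d1.hasFDerivAt (x := x)).smul_const (d0 : 𝔼 2 →L[ℝ] ℝ))

/-- **The derivative of the coefficient at a point of the axes** (`x₀ x₁ = 0`, `x ≠ 0`):
`dc_x = (2 ε / |x|⁴) (x₁ dx₀ + x₀ dx₁)` (the term through `d|x|⁻⁴` is killed by `x₀ x₁ = 0`).
[folklore] -/
theorem hasFDerivAt_coef (ε : ℝ) {x : 𝔼 2} (hx : nsq x ≠ 0) (hax : x 0 * x 1 = 0) :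
    HasFDerivAt (coef ε)
      ((2 * ε / nsq x ^ 2) • ((x 1) • (d0 : 𝔼 2 →L[ℝ] ℝ) + (x 0) • (d1 : 𝔼 2 →L[ℝ] ℝ))) x := by
  -- `P = x₀ x₁`, `Q = |x|⁻⁴`
  have hP : HasFDerivAt (fun y : 𝔼 2 => (d0 : 𝔼 2 →L[ℝ] ℝ) y * (d1 : 𝔼 2 →L[ℝ] ℝ) y)
      ((x 0) • (d1 : 𝔼 2 →L[ℝ] ℝ) + (x 1) • (d0 : 𝔼 2 →L[ℝ] ℝ)) x := by
    have := (d0.hasFDerivAt (x := x)).mul (d1.hasFDerivAt (x := x))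
    refine this.congr_fderiv ?_
    ext v; simp
  have hD2 : HasFDerivAt (fun y : 𝔼 2 => nsq y ^ 2)
      ((2 * nsq x) • ((2 * x 0) • (d0 : 𝔼 2 →L[ℝ] ℝ) + (2 * x 1) • (d1 : 𝔼 2 →L[ℝ] ℝ))) x := by
    have := (hasFDerivAt_nsq x).pow 2
    refine this.congr_fderiv ?_
    ext v; simp
  have hx2 : nsq x ^ 2 ≠ 0 := pow_ne_zero 2 hx
  have hQ : HasFDerivAt (fun y : 𝔼 2 => (nsq y ^ 2)⁻¹)
      ((-((nsq x ^ 2) ^ 2)⁻¹) • ((2 * nsq x) • ((2 * x 0) • (d0 : 𝔼 2 →L[ℝ] ℝ) +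
        (2 * x 1) • (d1 : 𝔼 2 →L[ℝ] ℝ)))) x :=
    (hasDerivAt_inv hx2).comp_hasFDerivAt x hD2
  have hPQ := hP.mul hQ
  have h := hPQ.const_mul (2 * ε)
  have hfun : coef ε = fun y => 2 * ε * ((d0 : 𝔼 2 →L[ℝ] ℝ) y * (d1 : 𝔼 2 →L[ℝ] ℝ) y * (nsq y ^ 2)⁻¹) := by
    funext y; simp [coef, div_eq_mul_inv]; ring
  rw [hfun]
  refine h.congr_fderiv ?_
  have hP0 : (d0 : 𝔼 2 →L[ℝ] ℝ) x * (d1 : 𝔼 2 →L[ℝ] ℝ) x = 0 := by simpa using hax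
  ext v
  simp only [smul_apply, add_apply, d0_apply, d1_apply, smul_eq_mul]
  rw [nsq_apply] at hx ⊢
  rcases mul_eq_zero.1 hax with h0 | h1
  · have h1 : x 1 ≠ 0 := fun h => hx (by simp [h0, h])
    simp only [h0]
    field_simp
    ring
  · have h0 : x 0 ≠ 0 := fun h => hx (by simp [h1, h])
    simp only [h1]
    field_simp
    ring

/-- The differentiated `dg`, as a function: `x ↦ c(x) • V(x)`, has derivative
`v ↦ dc_x(v) • V(x)` at a point of the axes (`c = 0` there). [folklore] -/
theorem hasFDerivAt_coef_smul_rotForm (ε : ℝ) {x : 𝔼 2} (hx : nsq x ≠ 0) (hax : x 0 * x 1 = 0) :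
    HasFDerivAt (fun y => coef ε y • rotForm y)
      (((2 * ε / nsq x ^ 2) • ((x 1) • (d0 : 𝔼 2 →L[ℝ] ℝ) + (x 0) • (d1 : 𝔼 2 →L[ℝ] ℝ))).smulRight
        (rotForm x)) x := by
  have hc0 : coef ε x = 0 := by
    simp [coef, show 2 * ε * x 0 * x 1 = 2 * ε * (x 0 * x 1) by ring, hax]
  have h := (hasFDerivAt_coef ε hx hax).smul (hasFDerivAt_rotForm x)
  rw [hc0, zero_smul, zero_add] at h
  exact h

/-- Near a point off the origin, `fderiv g = c • V`. [folklore] -/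
theorem fderiv_gcore_eventuallyEq (ε : ℝ) {x : 𝔼 2} (hx : nsq x ≠ 0) :
    fderiv ℝ (gcore ε) =ᶠ[𝓝 x] fun y => coef ε y • rotForm y := by
  have hopen : IsOpen {y : 𝔼 2 | nsq y ≠ 0} := isOpen_ne_fun (contDiff_nsq (m := 0)).continuous continuous_const
  filter_upwards [hopen.mem_nhds hx] with y hy
  exact fderiv_gcore_eq ε hy

/-- **The second derivative of the planar core at a point of the axes** (`x ≠ 0`,
`x₀ x₁ = 0`): `D²g_x(v, w) = (2 ε / |x|⁴) (x₁ v₀ + x₀ v₁) (x₀ w₁ - x₁ w₀)`; at `(r, 0)` this is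
`(2ε/r²) v₁ w₁` (a minimum along the circle), at `(0, r)` it is `-(2ε/r²) v₀ w₀` (a maximum).
[cite: GayKirby2016, §4, Lemma 14] -/
theorem fderiv_fderiv_gcore_apply (ε : ℝ) {x : 𝔼 2} (hx : nsq x ≠ 0) (hax : x 0 * x 1 = 0)
    (v w : 𝔼 2) :
    fderiv ℝ (fderiv ℝ (gcore ε)) x v w =
      2 * ε / nsq x ^ 2 * (x 1 * v 0 + x 0 * v 1) * (x 0 * w 1 - x 1 * w 0) := by
  rw [(fderiv_gcore_eventuallyEq ε hx).fderiv_eq, (hasFDerivAt_coef_smul_rotForm ε hx hax).fderiv]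
  simp only [ContinuousLinearMap.smulRight_apply, smul_apply, rotForm_apply, add_apply, d0_apply,
    d1_apply, smul_eq_mul]

/-! ### The model function `Φ` on `ℝ³` and the tube function `𝒯 = rthicken Φ` on `ℝ⁴` -/

/-- **The model function** `Φ(x₀, x₁, b) = g(x) + (κ/η) |x|² b` on `ℝ³` (core coordinates
`x` and squared co-core radius `b`), whose radial thickening is the tube function.
[cite: GayKirby2016, §4, Lemma 14] -/
def phi (ε κ η : ℝ) (q : 𝔼 3) : ℝ :=
  gcore ε (PlanarThickening.proj q) + κ / η * nsq (PlanarThickening.proj q) * q 2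

/-- Unfolding of `phi`. [folklore] -/
theorem phi_apply (ε κ η : ℝ) (q : 𝔼 3) :
    phi ε κ η q = gcore ε (PlanarThickening.proj q) + κ / η * nsq (PlanarThickening.proj q) * q 2 :=
  rfl

/-- The core function of `Φ` is the planar core: `Φ ∘ ι = g`. [folklore] -/
theorem phi_comp_lift (ε κ η : ℝ) : phi ε κ η ∘ (lift : 𝔼 2 →L[ℝ] 𝔼 3) = gcore ε := by
  funext u
  simp [phi_apply]

/-- **The tube function** `𝒯 = rthicken Φ` on `ℝ⁴ = ℝ²_x × ℝ²_y`:
`𝒯(x, y) = 1 - ε x₀²/|x|² + (κ/η) |x|² |y|²`. [cite: GayKirby2016, §4, Lemma 14] -/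
def tube (ε κ η : ℝ) : 𝔼 4 → ℝ := rthicken (phi ε κ η)

/-- `𝒯 = rthicken Φ` (definitional). [folklore] -/
theorem tube_eq (ε κ η : ℝ) : tube ε κ η = rthicken (phi ε κ η) := rfl

/-- The planar projection of `toModel p` is the core projection of `p`. [folklore] -/
@[simp] theorem planarProj_toModel (p : 𝔼 4) : PlanarThickening.proj (toModel p) = proj p := by
  ext i; fin_cases i <;> simp

/-- `|π p|² = p₀² + p₁²`. [folklore] -/
theorem nsq_proj (p : 𝔼 4) : nsq (proj p) = p 0 ^ 2 + p 1 ^ 2 := by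
  simp [nsq_apply]

/-- **The tube function in coordinates**: `𝒯(p) = g(π p) + (κ/η) |x|² |y|²`. [folklore] -/
theorem tube_apply (ε κ η : ℝ) (p : 𝔼 4) :
    tube ε κ η p = gcore ε (proj p) + κ / η * nsq (proj p) * bsq p := by
  simp [tube_eq, rthicken_apply, phi_apply]

/-- **The tube function in coordinates**, fully expanded:
`𝒯(p) = 1 - ε p₀²/(p₀² + p₁²) + (κ/η) (p₀² + p₁²) (p₂² + p₃²)`. [cite: GayKirby2016, §4, Lemma 14] -/
theorem tube_apply' (ε κ η : ℝ) (p : 𝔼 4) :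
    tube ε κ η p = 1 - ε * (p 0 ^ 2 / (p 0 ^ 2 + p 1 ^ 2)) +
      κ / η * (p 0 ^ 2 + p 1 ^ 2) * (p 2 ^ 2 + p 3 ^ 2) := by
  rw [tube_apply, gcore_apply, nsq_proj, bsq_apply]
  simp

/-- **Flow invariance**: the tube function is invariant under Milnor's model flow
`(x, y) ↦ (e^{-t} x, e^{t} y)` of `ξ = (-x, y)`, indeed under `(x, y) ↦ (s x, s⁻¹ y)` for every
`s ≠ 0` (`g` is homogeneous of degree `0` and `|x|²|y|²` is invariant).
[cite: MilnorHCobordism1965, Def. 3.1] -/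
theorem tube_scale {ε κ η s : ℝ} (hs : s ≠ 0) (p : 𝔼 4) :
    tube ε κ η (WithLp.toLp 2 ![s * p 0, s * p 1, s⁻¹ * p 2, s⁻¹ * p 3]) = tube ε κ η p := by
  have hg : gcore ε (proj (WithLp.toLp 2 ![s * p 0, s * p 1, s⁻¹ * p 2, s⁻¹ * p 3])) =
      gcore ε (proj p) := by
    have : proj (WithLp.toLp 2 ![s * p 0, s * p 1, s⁻¹ * p 2, s⁻¹ * p 3]) = s • proj p := by
      ext i; fin_cases i <;> simp
    rw [this, gcore_smul hs]
  rw [tube_apply, tube_apply, hg, nsq_proj, nsq_proj, bsq_apply, bsq_apply]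
  simp only [Matrix.cons_val_zero, Matrix.cons_val_one, Matrix.cons_val]
  field_simp

/-- `Φ` is smooth off the `b`-axis `{x = 0}`. [folklore] -/
theorem contDiffAt_phi {m : WithTop ℕ∞} (ε κ η : ℝ) {q : 𝔼 3}
    (hq : nsq (PlanarThickening.proj q) ≠ 0) : ContDiffAt ℝ m (phi ε κ η) q := by
  have h1 : ContDiffAt ℝ m (fun q' : 𝔼 3 => gcore ε (PlanarThickening.proj q')) q :=
    (contDiffAt_gcore ε hq).comp q PlanarThickening.proj.contDiff.contDiffAt
  have h2 : ContDiff ℝ m (fun q' : 𝔼 3 => κ / η * nsq (PlanarThickening.proj q') *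
      (PlanarThickening.zc : 𝔼 3 →L[ℝ] ℝ) q') :=
    (contDiff_const.mul (contDiff_nsq.comp PlanarThickening.proj.contDiff)).mul
      PlanarThickening.zc.contDiff
  exact h1.add h2.contDiffAt

/-- The tube function is smooth off `{x = 0}`. [folklore] -/
theorem contDiffAt_tube {m : WithTop ℕ∞} (ε κ η : ℝ) {p : 𝔼 4} (hp : nsq (proj p) ≠ 0) :
    ContDiffAt ℝ m (tube ε κ η) p :=
  contDiffAt_rthicken (contDiffAt_phi ε κ η (by rwa [planarProj_toModel]))

/-- **The derivative of `Φ`** off the `b`-axis: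
`DΦ_q = Dg_{π q} ∘ π + (κ/η) (|π q|² dz + q₂ D|x|²_{π q} ∘ π)`. [folklore] -/
theorem hasFDerivAt_phi (ε κ η : ℝ) {q : 𝔼 3} (hq : nsq (PlanarThickening.proj q) ≠ 0) :
    HasFDerivAt (phi ε κ η)
      ((fderiv ℝ (gcore ε) (PlanarThickening.proj q)).comp PlanarThickening.proj +
        (κ / η) • ((nsq (PlanarThickening.proj q)) • (PlanarThickening.zc : 𝔼 3 →L[ℝ] ℝ) +
          (q 2) • (((2 * PlanarThickening.proj q 0) • (d0 : 𝔼 2 →L[ℝ] ℝ) +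
            (2 * PlanarThickening.proj q 1) • (d1 : 𝔼 2 →L[ℝ] ℝ)).comp PlanarThickening.proj))) q := by
  have h1 : HasFDerivAt (fun q' : 𝔼 3 => gcore ε (PlanarThickening.proj q'))
      ((fderiv ℝ (gcore ε) (PlanarThickening.proj q)).comp PlanarThickening.proj) q :=
    (((contDiffAt_gcore (m := 1) ε hq).differentiableAt one_ne_zero).hasFDerivAt).comp q
      PlanarThickening.proj.hasFDerivAt
  have hn : HasFDerivAt (fun q' : 𝔼 3 => nsq (PlanarThickening.proj q'))
      (((2 * PlanarThickening.proj q 0) • (d0 : 𝔼 2 →L[ℝ] ℝ) +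
        (2 * PlanarThickening.proj q 1) • (d1 : 𝔼 2 →L[ℝ] ℝ)).comp PlanarThickening.proj) q :=
    (hasFDerivAt_nsq _).comp q PlanarThickening.proj.hasFDerivAt
  have h2 := (hn.mul (PlanarThickening.zc : 𝔼 3 →L[ℝ] ℝ).hasFDerivAt).const_mul (κ / η)
  have h := h1.add h2
  have hfun : phi ε κ η = fun q' => gcore ε (PlanarThickening.proj q') +
      κ / η * (nsq (PlanarThickening.proj q') * (PlanarThickening.zc : 𝔼 3 →L[ℝ] ℝ) q') := by
    funext q'; simp [phi_apply, mul_assoc]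
  rw [hfun]
  exact h

/-- **`∂Φ/∂b = (κ/η) |x|²`** off the `b`-axis. [cite: GayKirby2016, §4, Lemma 14] -/
theorem fderiv_phi_ez (ε κ η : ℝ) {q : 𝔼 3} (hq : nsq (PlanarThickening.proj q) ≠ 0) :
    fderiv ℝ (phi ε κ η) q ez = κ / η * nsq (PlanarThickening.proj q) := by
  rw [(hasFDerivAt_phi ε κ η hq).fderiv]
  simp

/-- **Critical points of the tube function** (`ε ≠ 0`, `κ/η ≠ 0`, off `{x = 0}`): `D𝒯_p = 0`
iff `y = 0` and `x₀ x₁ = 0`, i.e. `p` lies on one of the two coordinate axes of the core plane.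
[cite: GayKirby2016, §4, Lemma 14] -/
theorem isMCriticalPt_tube_iff {ε κ η : ℝ} (hε : ε ≠ 0) (hκ : κ / η ≠ 0) {p : 𝔼 4}
    (hp : nsq (proj p) ≠ 0) :
    IsMCriticalPt (𝓡 4) (tube ε κ η) p ↔ p 2 = 0 ∧ p 3 = 0 ∧ p 0 * p 1 = 0 := by
  have hq : nsq (PlanarThickening.proj (toModel p)) ≠ 0 := by rwa [planarProj_toModel]
  have hd : DifferentiableAt ℝ (phi ε κ η) (toModel p) :=
    (contDiffAt_phi (m := 1) ε κ η hq).differentiableAt one_ne_zero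
  have hb : fderiv ℝ (phi ε κ η) (toModel p) ez ≠ 0 := by
    rw [fderiv_phi_ez ε κ η hq, planarProj_toModel]
    exact mul_ne_zero hκ hp
  rw [tube_eq, isMCriticalPt_rthicken_iff hd hb, phi_comp_lift, MorseBirth.isMCriticalPt_iff_fderiv,
    fderiv_gcore_eq_zero_iff hε hp]
  simp

/-- The same in terms of `fderiv`. [cite: GayKirby2016, §4, Lemma 14] -/
theorem fderiv_tube_eq_zero_iff {ε κ η : ℝ} (hε : ε ≠ 0) (hκ : κ / η ≠ 0) {p : 𝔼 4}
    (hp : nsq (proj p) ≠ 0) :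
    fderiv ℝ (tube ε κ η) p = 0 ↔ p 2 = 0 ∧ p 3 = 0 ∧ p 0 * p 1 = 0 := by
  rw [← MorseBirth.isMCriticalPt_iff_fderiv, isMCriticalPt_tube_iff hε hκ hp]

/-- **The Hessian of the tube function at a point of the axes** (`p = (x, 0)` with `x ≠ 0`,
`x₀ x₁ = 0`): `D²𝒯_p(v, w) = (2ε/|x|⁴)(x₁v₀ + x₀v₁)(x₀w₁ - x₁w₀) + (2κ|x|²/η)(v₂w₂ + v₃w₃)`.
At `(r, 0, 0, 0)` this is `(2ε/r²) v₁w₁ + (2κr²/η)(v₂w₂ + v₃w₃)`, at `(0, r, 0, 0)` it is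
`-(2ε/r²) v₀w₀ + (2κr²/η)(v₂w₂ + v₃w₃)`. [cite: GayKirby2016, §4, Lemma 14] [cite: Milnor1963, §2] -/
theorem fderiv_fderiv_tube_apply (ε κ η : ℝ) {p : 𝔼 4} (hp : nsq (proj p) ≠ 0) (h2 : p 2 = 0)
    (h3 : p 3 = 0) (hax : p 0 * p 1 = 0) (v w : 𝔼 4) :
    fderiv ℝ (fderiv ℝ (tube ε κ η)) p v w =
      2 * ε / nsq (proj p) ^ 2 * (p 1 * v 0 + p 0 * v 1) * (p 0 * w 1 - p 1 * w 0) +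
        2 * (κ / η * nsq (proj p)) * (v 2 * w 2 + v 3 * w 3) := by
  have hq : nsq (PlanarThickening.proj (toModel p)) ≠ 0 := by rwa [planarProj_toModel]
  have hΦ : ContDiffAt ℝ 2 (phi ε κ η) (toModel p) := contDiffAt_phi ε κ η hq
  rw [tube_eq, fderiv_fderiv_rthicken_apply hΦ h2 h3, phi_comp_lift,
    fderiv_fderiv_gcore_apply ε hp (by simpa using hax), fderiv_phi_ez ε κ η hq, planarProj_toModel]
  simp

/-- The Hessian of the tube function at a point of the axes, in the tree's `mhessian`
vocabulary on the model space `𝓡 4`. [cite: Milnor1963, §2] -/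
theorem mhessian_tube_apply (ε κ η : ℝ) {p : 𝔼 4} (hp : nsq (proj p) ≠ 0) (h2 : p 2 = 0)
    (h3 : p 3 = 0) (hax : p 0 * p 1 = 0) (v w : 𝔼 4) :
    mhessian (𝓡 4) (tube ε κ η) p v w =
      2 * ε / nsq (proj p) ^ 2 * (p 1 * v 0 + p 0 * v 1) * (p 0 * w 1 - p 1 * w 0) +
        2 * (κ / η * nsq (proj p)) * (v 2 * w 2 + v 3 * w 3) := by
  rw [MorseBirth.mhessian_model_apply, fderiv_fderiv_tube_apply ε κ η hp h2 h3 hax]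

/-- **The Hessian at `(r, 0, 0, 0)`** (`r ≠ 0`): `(2ε/r²) v₁w₁ + (2κr²/η)(v₂w₂ + v₃w₃)`.
[cite: GayKirby2016, §4, Lemma 14] -/
theorem fderiv_fderiv_tube_apply_of_eq_zero_one (ε κ η : ℝ) {p : 𝔼 4} (h0 : p 0 ≠ 0)
    (h1 : p 1 = 0) (h2 : p 2 = 0) (h3 : p 3 = 0) (v w : 𝔼 4) :
    fderiv ℝ (fderiv ℝ (tube ε κ η)) p v w =
      2 * ε / p 0 ^ 2 * (v 1 * w 1) + 2 * (κ / η * p 0 ^ 2) * (v 2 * w 2 + v 3 * w 3) := by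
  have hp : nsq (proj p) ≠ 0 := by rw [nsq_proj, h1]; simpa using h0
  rw [fderiv_fderiv_tube_apply ε κ η hp h2 h3 (by rw [h1, mul_zero]), nsq_proj, h1]
  have h0' : p 0 ^ 2 ≠ 0 := pow_ne_zero 2 h0
  field_simp
  ring

/-- **The Hessian at `(0, r, 0, 0)`** (`r ≠ 0`): `-(2ε/r²) v₀w₀ + (2κr²/η)(v₂w₂ + v₃w₃)`.
[cite: GayKirby2016, §4, Lemma 14] -/
theorem fderiv_fderiv_tube_apply_of_eq_zero_zero (ε κ η : ℝ) {p : 𝔼 4} (h0 : p 0 = 0)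
    (h1 : p 1 ≠ 0) (h2 : p 2 = 0) (h3 : p 3 = 0) (v w : 𝔼 4) :
    fderiv ℝ (fderiv ℝ (tube ε κ η)) p v w =
      -(2 * ε / p 1 ^ 2) * (v 0 * w 0) + 2 * (κ / η * p 1 ^ 2) * (v 2 * w 2 + v 3 * w 3) := by
  have hp : nsq (proj p) ≠ 0 := by rw [nsq_proj, h0]; simpa using h1
  rw [fderiv_fderiv_tube_apply ε κ η hp h2 h3 (by rw [h0, zero_mul]), nsq_proj, h0]
  have h1' : p 1 ^ 2 ≠ 0 := pow_ne_zero 2 h1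
  field_simp
  ring

/-! ### Signatures of the restricted Hessians

On the level `Y = {|x|² = η + |y|²}` through `(r, 0, 0, 0)` resp. `(0, r, 0, 0)` the tangent
hyperplane is `{v₀ = 0}` resp. `{v₁ = 0}`; restricted there the Hessians above are
`(2ε/r²) v₁² + (2κr²/η)(v₂² + v₃²)` (positive definite: index `0`) resp.
`-(2ε/r²) v₀² + (2κr²/η)(v₂² + v₃²)` (nondegenerate of index `1`).  The statements are about an
arbitrary bilinear form `B` on `ℝ⁴` given by such a formula and an arbitrary submodule `V` with
the said membership, which is how `RegularLevelMorseData.lean` consumes them. -/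

/-- The core coordinate functional `dx₀ : p ↦ p₀` on `ℝ⁴`, as a linear map. [folklore] -/
abbrev d0₄ : 𝔼 4 →ₗ[ℝ] ℝ := (EuclideanSpace.proj (0 : Fin 4) : 𝔼 4 →L[ℝ] ℝ).toLinearMap

/-- `dx₀ p = p₀`. [folklore] -/
@[simp] theorem d0₄_apply (p : 𝔼 4) : d0₄ p = p 0 := rfl

section Restrict

variable {B : LinearMap.BilinForm ℝ (𝔼 4)} {V : Submodule ℝ (𝔼 4)} {a b : ℝ}

/-- The basis vector `eᵢ` of `ℝ⁴`. [folklore] -/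
def E4 (i : Fin 4) : 𝔼 4 := WithLp.toLp 2 (Pi.single i 1)

/-- Coordinates of `eᵢ`. [folklore] -/
@[simp] theorem E4_apply (i j : Fin 4) : E4 i j = if j = i then 1 else 0 := by
  simp [E4]

/-- **Index `0` at `(±r, 0, 0, 0)`**: a form `a v₁w₁ + b(v₂w₂ + v₃w₃)` with `a, b > 0` is
positive definite on `V = {v₀ = 0}`. [cite: GayKirby2016, §4, Lemma 14] [cite: Milnor1963, §2] -/
theorem posDef_restrict_of_apply_eq (ha : 0 < a) (hb : 0 < b)
    (hB : ∀ v w, B v w = a * (v 1 * w 1) + b * (v 2 * w 2 + v 3 * w 3))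
    (hV : ∀ v, v ∈ V ↔ v 0 = 0) :
    (B.restrict V).toQuadraticMap.PosDef := by
  intro x hx
  have hx0 : (x : 𝔼 4) 0 = 0 := (hV _).1 x.2
  have hne : (x : 𝔼 4) 1 ≠ 0 ∨ (x : 𝔼 4) 2 ≠ 0 ∨ (x : 𝔼 4) 3 ≠ 0 := by
    by_contra h
    simp only [not_or, not_not] at h
    apply hx
    refine Subtype.ext ?_
    ext i
    fin_cases i
    · simpa using hx0
    · simpa using h.1
    · simpa using h.2.1
    · simpa using h.2.2
  simp only [LinearMap.BilinMap.toQuadraticMap_apply, LinearMap.BilinForm.restrict_apply,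
    LinearMap.domRestrict_apply, hB]
  rcases hne with h | h | h
  · have := sq_pos_of_ne_zero h
    nlinarith [sq_nonneg ((x : 𝔼 4) 2), sq_nonneg ((x : 𝔼 4) 3), mul_pos ha this]
  · have := sq_pos_of_ne_zero h
    nlinarith [sq_nonneg ((x : 𝔼 4) 1), sq_nonneg ((x : 𝔼 4) 3), mul_pos hb this, mul_nonneg ha.le (sq_nonneg ((x : 𝔼 4) 1))]
  · have := sq_pos_of_ne_zero h
    nlinarith [sq_nonneg ((x : 𝔼 4) 1), sq_nonneg ((x : 𝔼 4) 2), mul_pos hb this, mul_nonneg ha.le (sq_nonneg ((x : 𝔼 4) 1))]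

/-- **Index `0` at `(±r, 0, 0, 0)`**: the restricted form is nondegenerate of negative index
of inertia `0`. [cite: GayKirby2016, §4, Lemma 14] [cite: Milnor1963, §2] -/
theorem nondegenerate_and_sigNeg_eq_zero_of_apply_eq (ha : 0 < a) (hb : 0 < b)
    (hB : ∀ v w, B v w = a * (v 1 * w 1) + b * (v 2 * w 2 + v 3 * w 3))
    (hV : ∀ v, v ∈ V ↔ v 0 = 0) :
    (B.restrict V).Nondegenerate ∧ sigNeg (B.restrict V).toQuadraticMap = 0 := by
  have hpd := posDef_restrict_of_apply_eq ha hb hB hV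
  refine ⟨⟨fun x hx => ?_, fun x hx => ?_⟩, LinearMap.BilinForm.sigNeg_eq_zero_of_posDef hpd⟩
  · by_contra h0
    have := hpd x h0
    simp only [LinearMap.BilinMap.toQuadraticMap_apply, hx x] at this
    exact lt_irrefl _ this
  · by_contra h0
    have := hpd x h0
    simp only [LinearMap.BilinMap.toQuadraticMap_apply, hx x] at this
    exact lt_irrefl _ this

/-- **Index `1` at `(0, ±r, 0, 0)`**: a form `-a v₀w₀ + b(v₂w₂ + v₃w₃)` with `a, b > 0`
restricted to `V = {v₁ = 0}` is nondegenerate of negative index of inertia `1` (the negative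
line `ℝ e₀` splits off a positive definite plane; `sigNeg_eq_of_proj`).
[cite: GayKirby2016, §4, Lemma 14] [cite: Milnor1963, §2] -/
theorem nondegenerate_and_sigNeg_eq_one_of_apply_eq (ha : 0 < a) (hb : 0 < b)
    (hB : ∀ v w, B v w = -a * (v 0 * w 0) + b * (v 2 * w 2 + v 3 * w 3))
    (hV : ∀ v, v ∈ V ↔ v 1 = 0) :
    (B.restrict V).Nondegenerate ∧ sigNeg (B.restrict V).toQuadraticMap = 1 := by
  have hE0 : E4 0 ∈ V := (hV _).2 (by simp)
  have hE2 : E4 2 ∈ V := (hV _).2 (by simp)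
  have hE3 : E4 3 ∈ V := (hV _).2 (by simp)
  -- nondegeneracy: test against `e₀, e₂, e₃ ∈ V`
  have hsep : ∀ x : V, (∀ y : V, B x y = 0) → x = 0 := by
    intro x hx
    have hx1 : (x : 𝔼 4) 1 = 0 := (hV _).1 x.2
    have h0 := hx ⟨E4 0, hE0⟩
    have h2 := hx ⟨E4 2, hE2⟩
    have h3 := hx ⟨E4 3, hE3⟩
    simp only [hB, E4_apply] at h0 h2 h3
    simp only [Fin.isValue, ↓reduceIte, mul_one, Fin.reduceEq, mul_zero, add_zero, zero_add,
      neg_mul, neg_eq_zero, mul_eq_zero, ha.ne', hb.ne', false_or] at h0 h2 h3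
    refine Subtype.ext ?_
    ext i
    fin_cases i
    · simpa using h0
    · simpa using hx1
    · simpa using h2
    · simpa using h3
  have hsymm : ∀ x y : V, B x y = B y x := fun x y => by
    rw [hB, hB]; ring
  refine ⟨⟨fun x hx => hsep x (fun y => by simpa using hx y),
    fun x hx => hsep x (fun y => by rw [hsymm]; simpa using hx y)⟩, ?_⟩
  -- the index: project to the `v₀`-line
  let π : V →ₗ[ℝ] ℝ := (d0₄ : 𝔼 4 →ₗ[ℝ] ℝ).comp V.subtype
  let ι : ℝ →ₗ[ℝ] V := LinearMap.codRestrict V (LinearMap.toSpanSingleton ℝ (𝔼 4) (E4 0))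
    (fun t => V.smul_mem t hE0)
  let Q' : QuadraticForm ℝ ℝ :=
    LinearMap.BilinMap.toQuadraticMap ((-a) • (LinearMap.mul ℝ ℝ : ℝ →ₗ[ℝ] ℝ →ₗ[ℝ] ℝ))
  have hQ' : ∀ t : ℝ, Q' t = -a * (t * t) := fun t => by
    simp [Q']
  have hQ : ∀ x : V, (B.restrict V).toQuadraticMap x =
      -a * ((x : 𝔼 4) 0 * (x : 𝔼 4) 0) + b * ((x : 𝔼 4) 2 * (x : 𝔼 4) 2 + (x : 𝔼 4) 3 * (x : 𝔼 4) 3) :=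
    fun x => by simp [LinearMap.BilinMap.toQuadraticMap_apply, hB]
  have key : sigNeg (B.restrict V).toQuadraticMap = sigNeg Q' := by
    refine sigNeg_eq_of_proj _ Q' π ι (fun x => ?_) (fun x hx => ?_) (fun t => ?_) (fun t => ?_)
    · rw [hQ, hQ']
      simp only [π, LinearMap.coe_comp, Submodule.coe_subtype, comp_apply, d0₄_apply]
      nlinarith [sq_nonneg ((x : 𝔼 4) 2), sq_nonneg ((x : 𝔼 4) 3)]
    · simp only [π, LinearMap.coe_comp, Submodule.coe_subtype, comp_apply, d0₄_apply] at hx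
      rw [hQ, hx]
      nlinarith [sq_nonneg ((x : 𝔼 4) 2), sq_nonneg ((x : 𝔼 4) 3)]
    · rw [hQ, hQ']
      simp [ι]
    · simp [π, ι]
  rw [key]
  -- `sigNeg (-a t²) = 1` on the line
  apply le_antisymm
  · calc sigNeg Q' = sigPos (-Q') := by rw [sigPos_neg]
      _ ≤ Module.finrank ℝ ℝ := sigPos_le_finrank _
      _ = 1 := Module.finrank_self ℝ
  · have hneg : ((-Q').restrict ⊤).PosDef := by
      intro t ht
      have ht' : (t : ℝ) ≠ 0 := fun h => ht (Subtype.ext h)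
      simp only [QuadraticMap.restrict_apply, QuadraticMap.neg_apply, hQ']
      nlinarith [mul_pos ha (mul_self_pos.2 ht')]
    have := le_sigNeg_of_negDef Q' hneg
    rw [finrank_top, Module.finrank_self] at this
    exact this

end Restrict

/-! ### The tube function and Milnor's model data of the `2`-handle

In Milnor's coordinates the Morse function is `f = f(c) + Q₂`, `Q₂ = -|x|² + |y|²`
(`milnorQuadratic 2`), with gradient-like field `ξ = (-x, y)` (`milnorModelField 2`).  The tube
function is a first integral of `ξ`, so on a level of `f` its critical points as a function
on the level are exactly its critical points as a function on `ℝ⁴` (Lagrange: `D𝒯 = λ DQ₂`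
and `D𝒯(ξ) = 0 < DQ₂(ξ)` force `λ = 0`), and the tangent hyperplanes of the level at the four
axis points are `ker DQ₂ = {v₀ = 0}` resp. `{v₁ = 0}`. -/

/-- **The first derivative of the tube function** off `{x = 0}`:
`D𝒯_p(v) = Dg_{πp}(πv) + (κ/η)(|y|² · 2⟨x, v_x⟩ + |x|² · 2⟨y, v_y⟩)`. [folklore] -/
theorem fderiv_tube_apply (ε κ η : ℝ) {p : 𝔼 4} (hp : nsq (proj p) ≠ 0) (v : 𝔼 4) :
    fderiv ℝ (tube ε κ η) p v = fderiv ℝ (gcore ε) (proj p) (proj v) +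
      κ / η * (bsq p * (2 * p 0 * v 0 + 2 * p 1 * v 1) +
        nsq (proj p) * (2 * p 2 * v 2 + 2 * p 3 * v 3)) := by
  have hq : nsq (PlanarThickening.proj (toModel p)) ≠ 0 := by rwa [planarProj_toModel]
  have hd : DifferentiableAt ℝ (phi ε κ η) (toModel p) :=
    (contDiffAt_phi (m := 1) ε κ η hq).differentiableAt one_ne_zero
  rw [tube_eq, fderiv_rthicken_apply hd, (hasFDerivAt_phi ε κ η hq).fderiv]
  simp
  ring

/-- Milnor's model field of index `2` on `ℝ⁴` in coordinates: `ξ(p) = (-p₀, -p₁, p₂, p₃)`.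
[cite: MilnorHCobordism1965, Def. 3.1] -/
theorem milnorModelField_two_apply (p : 𝔼 4) (i : Fin 4) :
    milnorModelField 2 p i = if i = 0 ∨ i = 1 then -(p i) else p i := by
  rw [milnorModelField_apply]
  fin_cases i <;> simp

/-- **The tube function is a first integral of Milnor's model field**: `D𝒯_p(ξ_p) = 0` off
`{x = 0}` (`g` is constant along the rays of the `x`-plane and `|x|²|y|²` is invariant under
`(x, y) ↦ (e^{-t}x, e^{t}y)`). [cite: MilnorHCobordism1965, Def. 3.1] [cite: GayKirby2016, §4, Lemma 14] -/
theorem fderiv_tube_milnorModelField (ε κ η : ℝ) {p : 𝔼 4} (hp : nsq (proj p) ≠ 0) :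
    fderiv ℝ (tube ε κ η) p (milnorModelField 2 p) = 0 := by
  rw [fderiv_tube_apply ε κ η hp, fderiv_gcore ε hp]
  simp [nsq_proj, bsq_apply]
  ring

/-- `Q₂ = -|x|² + |y|²` on `ℝ⁴` in coordinates. [cite: MilnorHCobordism1965, Def. 3.1] -/
theorem milnorQuadratic_two_apply (z : 𝔼 4) :
    milnorQuadratic (m := 4) 2 z = -(z 0 ^ 2 + z 1 ^ 2) + (z 2 ^ 2 + z 3 ^ 2) := by
  rw [milnorQuadratic_eq_sum, Fin.sum_univ_four]
  simp
  ring

/-- **Below the critical level the core coordinates do not vanish**: `Q₂(z) < 0 ⇒ |x|² > 0`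
(on the level `Y = f⁻¹(f(c) - η)` of the attaching circle, `|x|² = η + |y|² ≥ η`).
[cite: MilnorHCobordism1965, Def. 3.1] -/
theorem nsq_proj_ne_zero_of_milnorQuadratic_neg {z : 𝔼 4} (hz : milnorQuadratic (m := 4) 2 z < 0) :
    nsq (proj z) ≠ 0 := by
  rw [nsq_proj]
  rw [milnorQuadratic_two_apply] at hz
  intro h
  nlinarith [sq_nonneg (z 2), sq_nonneg (z 3)]

/-- The Hessian of `Q₂ = -|x|² + |y|²` on `ℝ⁴` in coordinates. [folklore] -/
theorem milnorHessian_two_apply (z v : 𝔼 4) :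
    milnorHessian 2 z v = -2 * z 0 * v 0 - 2 * z 1 * v 1 + 2 * z 2 * v 2 + 2 * z 3 * v 3 := by
  rw [milnorHessian_apply_apply, Fin.sum_univ_four]
  simp [milnorSign_apply]
  ring

/-- `DQ₂` on `ℝ⁴` in coordinates: `DQ₂_z(v) = -2z₀v₀ - 2z₁v₁ + 2z₂v₂ + 2z₃v₃`. [folklore] -/
theorem fderiv_milnorQuadratic_two_apply (z v : 𝔼 4) :
    fderiv ℝ (milnorQuadratic (m := 4) 2) z v =
      -2 * z 0 * v 0 - 2 * z 1 * v 1 + 2 * z 2 * v 2 + 2 * z 3 * v 3 := by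
  rw [fderiv_milnorQuadratic, milnorHessian_two_apply]

/-- `DQ₂_z(ξ_z) = 2|z|² > 0` off the origin (here: off `{x = 0}`). [cite: MilnorHCobordism1965, proof of Lemma 3.2] -/
theorem fderiv_milnorQuadratic_two_milnorModelField_pos {z : 𝔼 4} (hz : nsq (proj z) ≠ 0) :
    0 < fderiv ℝ (milnorQuadratic (m := 4) 2) z (milnorModelField 2 z) := by
  rw [fderiv_milnorQuadratic_two_apply]
  simp only [milnorModelField_two_apply]
  simp only [Fin.isValue, true_or, ↓reduceIte, mul_neg, neg_mul, neg_neg, sub_neg_eq_add, or_true,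
    Fin.reduceEq, or_self]
  rw [nsq_proj] at hz
  have : 0 < z 0 ^ 2 + z 1 ^ 2 := lt_of_le_of_ne (by positivity) (Ne.symm hz)
  nlinarith [sq_nonneg (z 2), sq_nonneg (z 3)]

/-- **The tangent hyperplane of the level at `(r, 0, 0, 0)`** (`r ≠ 0`): `ker DQ₂ = {v₀ = 0}`.
[folklore] -/
theorem fderiv_milnorQuadratic_two_eq_zero_iff_of_axis₀ {z : 𝔼 4} (h0 : z 0 ≠ 0) (h1 : z 1 = 0)
    (h2 : z 2 = 0) (h3 : z 3 = 0) (v : 𝔼 4) :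
    fderiv ℝ (milnorQuadratic (m := 4) 2) z v = 0 ↔ v 0 = 0 := by
  rw [fderiv_milnorQuadratic_two_apply, h1, h2, h3]
  simp [h0]

/-- **The tangent hyperplane of the level at `(0, r, 0, 0)`** (`r ≠ 0`): `ker DQ₂ = {v₁ = 0}`.
[folklore] -/
theorem fderiv_milnorQuadratic_two_eq_zero_iff_of_axis₁ {z : 𝔼 4} (h0 : z 0 = 0) (h1 : z 1 ≠ 0)
    (h2 : z 2 = 0) (h3 : z 3 = 0) (v : 𝔼 4) :
    fderiv ℝ (milnorQuadratic (m := 4) 2) z v = 0 ↔ v 1 = 0 := by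
  rw [fderiv_milnorQuadratic_two_apply, h0, h2, h3]
  simp [h1]

/-- **Lagrange multipliers, degenerate case**: if `ker ℓ ⊆ ker m` and some vector `ξ` has
`ℓ ξ ≠ 0` but `m ξ = 0`, then `m = 0` (`m = λ ℓ` with `λ ℓ ξ = m ξ = 0`). [folklore] -/
theorem clm_eq_zero_of_forall_apply_eq_zero {E : Type*} [AddCommGroup E] [Module ℝ E]
    [TopologicalSpace E] {ℓ m : E →L[ℝ] ℝ} (h : ∀ v, ℓ v = 0 → m v = 0) {ξ : E} (hℓ : ℓ ξ ≠ 0)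
    (hm : m ξ = 0) : m = 0 := by
  ext v
  have hv : ℓ (v - (ℓ v / ℓ ξ) • ξ) = 0 := by
    rw [map_sub, map_smul, smul_eq_mul, div_mul_cancel₀ _ hℓ, sub_self]
  have := h _ hv
  rwa [map_sub, map_smul, hm, smul_zero, sub_zero] at this

/-- **Critical points of the tube function along a level of `Q₂` are its critical points**
(off `{x = 0}`): `D𝒯_z` vanishes on `ker DQ₂_z` iff `D𝒯_z = 0`, because `D𝒯_z(ξ_z) = 0`
while `DQ₂_z(ξ_z) > 0`.  With `RegularLevel.isMCriticalPt_comp_incl_iff_of_chart` this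
identifies the critical points of the Heegaard function `𝒯|Y` near the attaching circle with
the four axis points. [cite: GayKirby2016, §4, Lemma 14] -/
theorem forall_fderiv_tube_eq_zero_iff (ε κ η : ℝ) {z : 𝔼 4} (hz : nsq (proj z) ≠ 0) :
    (∀ v, fderiv ℝ (milnorQuadratic (m := 4) 2) z v = 0 → fderiv ℝ (tube ε κ η) z v = 0) ↔
      fderiv ℝ (tube ε κ η) z = 0 := by
  constructor
  · intro h
    exact clm_eq_zero_of_forall_apply_eq_zero h
      (fderiv_milnorQuadratic_two_milnorModelField_pos hz).ne' (fderiv_tube_milnorModelField ε κ η hz)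
  · intro h v _
    rw [h, zero_apply]

/-- The same with a translation `z ↦ z - u₀` in both functions (uncentred Milnor coordinates)
and an additive constant in `Q₂`. [cite: GayKirby2016, §4, Lemma 14] -/
theorem forall_fderiv_tube_sub_eq_zero_iff (ε κ η c : ℝ) (u₀ : 𝔼 4) {u : 𝔼 4}
    (hz : nsq (proj (u - u₀)) ≠ 0) :
    (∀ v, fderiv ℝ (fun w : 𝔼 4 => c + milnorQuadratic 2 (w - u₀)) u v = 0 →
        fderiv ℝ (fun w : 𝔼 4 => tube ε κ η (w - u₀)) u v = 0) ↔
      fderiv ℝ (fun w : 𝔼 4 => tube ε κ η (w - u₀)) u = 0 := by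
  have hQ : fderiv ℝ (fun w : 𝔼 4 => c + milnorQuadratic 2 (w - u₀)) u =
      fderiv ℝ (milnorQuadratic (m := 4) 2) (u - u₀) := by
    rw [fderiv_const_add_milnorQuadratic_sub, fderiv_milnorQuadratic]
  have hT : fderiv ℝ (fun w : 𝔼 4 => tube ε κ η (w - u₀)) u = fderiv ℝ (tube ε κ η) (u - u₀) := by
    exact fderiv_comp_sub u₀
  rw [hQ, hT]
  exact forall_fderiv_tube_eq_zero_iff ε κ η hz

/-- Second derivatives commute with the translation `w ↦ w - u₀`. [folklore] -/
theorem fderiv_fderiv_comp_sub_const {E F : Type*} [NormedAddCommGroup E] [NormedSpace ℝ E]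
    [NormedAddCommGroup F] [NormedSpace ℝ F] (g : E → F) (u₀ u : E) :
    fderiv ℝ (fderiv ℝ (fun w => g (w - u₀))) u = fderiv ℝ (fderiv ℝ g) (u - u₀) := by
  have h : fderiv ℝ (fun w => g (w - u₀)) = fun w => fderiv ℝ g (w - u₀) := by
    funext w
    exact fderiv_comp_sub u₀
  rw [h]
  exact fderiv_comp_sub u₀

/-- **Values of the tube function at the four axis points**: `1 - ε` at `(±r, 0, 0, 0)`.
[cite: GayKirby2016, §4, Lemma 14] -/
theorem tube_apply_of_axis₀ (ε κ η : ℝ) {p : 𝔼 4} (h0 : p 0 ≠ 0) (h1 : p 1 = 0) (h2 : p 2 = 0)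
    (h3 : p 3 = 0) : tube ε κ η p = 1 - ε := by
  rw [tube_apply', h1, h2, h3]
  have : p 0 ^ 2 ≠ 0 := pow_ne_zero 2 h0
  field_simp
  ring

/-- **Values of the tube function at the four axis points**: `1` at `(0, ±r, 0, 0)`.
[cite: GayKirby2016, §4, Lemma 14] -/
theorem tube_apply_of_axis₁ (ε κ η : ℝ) {p : 𝔼 4} (h0 : p 0 = 0) (h2 : p 2 = 0) (h3 : p 3 = 0) :
    tube ε κ η p = 1 := by
  rw [tube_apply', h0, h2, h3]
  simp

/-- **Bounds**: `𝒯(p) - (κ/η)|x|²|y|² = g(x) ∈ [1 - ε, 1]` for `0 ≤ ε`. [folklore] -/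
theorem tube_sub_mem_Icc {ε : ℝ} (hε : 0 ≤ ε) (κ η : ℝ) (p : 𝔼 4) :
    tube ε κ η p - κ / η * (p 0 ^ 2 + p 1 ^ 2) * (p 2 ^ 2 + p 3 ^ 2) ∈ Icc (1 - ε) 1 := by
  rw [tube_apply']
  have hq : 0 ≤ p 0 ^ 2 / (p 0 ^ 2 + p 1 ^ 2) ∧ p 0 ^ 2 / (p 0 ^ 2 + p 1 ^ 2) ≤ 1 := by
    by_cases h : p 0 ^ 2 + p 1 ^ 2 = 0
    · rw [h, div_zero]; exact ⟨le_rfl, zero_le_one⟩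
    · have hpos : 0 < p 0 ^ 2 + p 1 ^ 2 := lt_of_le_of_ne (by positivity) (Ne.symm h)
      exact ⟨by positivity, (div_le_one hpos).2 (by nlinarith [sq_nonneg (p 1)])⟩
  constructor <;> nlinarith [mul_nonneg hε hq.1, mul_le_mul_of_nonneg_left hq.2 hε]

end TubeModel

end Literature.Topology.FourManifolds

end
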